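import Mathlib
import HarnessLib
import Summits.HubbardSuperconductivity.HubbardSuperconductivity.Theorems.KLProgrammeKLRegimeTwoVolumeLipStepLinkUniform
import Summits.HubbardSuperconductivity.HubbardSuperconductivity.Theorems.KLProgrammeKLRegimeEngineTowerLipschitzStepImage

/-!
# Route `KLProgramme` — crux K3 ENGINE (stmt-HubbardSuperconductivity-20437 `KLRegimeEngineV17F2`), stub (e) proof-input «(e)-D-ROWS», F-D7b (model half): THE
# TWO-VOLUME BLOCK STEP IN BUDGET FORM — the `hstep` hypothesis of `EngineV8.towerDiff_le_of_geomBudget` at the model, one block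
# (seat hubbard-kl-k3c4-p1 g25, VL lane; `--supports` 20437; DROWS-SCOPE-g25 §13.6 (step) = `…EngineTowerLipschitzStepImage` ∘ `…TwoVolumeLipStepLinkUniform`)

For one block `k ≥ 1` the LINK (`klLipBornDiffSup_le_kitStep_of_bounds`, p723305) gives the Lipschitz kit step for every truncation under the guard; the generic step
images (`lipStepImage_le_of_three_le'`, `lipStepImage_le_low'`, p723934/append) turn it into `db ≤ R·C_p + src` once the block's scaled difference array
`dμ m = 32(cW²/8)^m(dE m + (Λ⁻¹+t)(μF+μV)(m))` carries the budgeted four-piece profile `R·(κ₁λ, κ₂λ, κ₃λ², Aνλ^{m−1}Q′^m)` (the induction hypothesis of the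
difference tower) and the majorant `μb m = 32(cW²/8)^m(μV + (μF+μV) + dE)(m)` the one-volume four-piece profile.  Two theorems, degrees `p ≥ 3` (T3's weight) and
every `p ≥ 1` (weight `1`).  The constants `C_p` are explicit in `(σ̄, τ̄, ψ̄, Φ̄) = (κ̄²ε²/cW², 4e⁴κ̄²ε²/cW², cW²/(κ̄²ε²), eᾱ/κ̄²)` and the profile constants, hence
k-UNIFORM; the geometric budget of `towerDiff_le_of_geomBudget` then closes with any `Θ ≥ (C_p + S_p)/X_b p`.

* **`klLipBornDiffSup_le_budgetStep_of_three_le`**, **`klLipBornDiffSup_le_budgetStep_low`**.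

Compositions of landed theorems; nothing asserts the (D) rows, stub (e), VL, K3 or superconductivity.
References: BGM 2006 §2.8 (2.93)–(2.98), §3 (3.2)–(3.8) [cite: BenfattoGiulianiMastropietro2006].
-/

noncomputable section

namespace Summit.HubbardSuperconductivity.HubbardSuperconductivity.Theorems.TwoVolumeLip

set_option linter.dupNamespace false -- summit = problem name (single-conjunct summit), D-0017

open Finset Literature.MathematicalPhysics.QuantumLattice GrassmannAlgebra Literature.Probability.LatticeModels
  Literature.Probability.LatticeModels.BattleFederbush
open Literature.MathematicalPhysics.QuantumLattice.FermiRG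
open Summit.HubbardSuperconductivity.HubbardSuperconductivity.Theorems.KLRegimeSplit
open Summit.HubbardSuperconductivity.HubbardSuperconductivity.Theorems.KLProgrammeLegKernels
open Summit.HubbardSuperconductivity.HubbardSuperconductivity.Theorems.DispersionFlow
open Summit.HubbardSuperconductivity.HubbardSuperconductivity.Theorems.EngineV8
open Summit.HubbardSuperconductivity.HubbardSuperconductivity.Theorems.TwoVolumeSource
open Summit.HubbardSuperconductivity.HubbardSuperconductivity.Theorems.TwoVolumeDefect

variable {L b M : ℕ} [NeZero L] [NeZero (b * L)] [NeZero M]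

set_option maxHeartbeats 1600000 in -- large statement
/-- **The two-volume block step in BUDGET form, degrees `p ≥ 3`** (`…EngineTowerLipschitzStepImage.lipStepImage_le_of_three_le'` ∘ the LINK): block `k ≥ 1`, the LINK's data verbatim; if the scaled difference array `dμ` of the block has the budgeted four-piece profile `R·(κ₁λ, κ₂λ, κ₃λ², Aνλ^{m−1}Q′^m)` and the majorant `μb` the four-piece profile `(ι₁λ, ι₂λ, ι₃λ², A′λ^{m−1}Q′^m)`, then under the soft kit conditions at the LINK's constants `σ̄ τ̄ ψ̄ Φ̄` the born difference in floor units is `≤ R·C_p + SRC/(ε·klLevUnitF β M 0 p (dk))` with the explicit `C_p` of `lipStepImage_le_of_three_le'`. -/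
theorem klLipBornDiffSup_le_budgetStep_of_three_le {β : ℝ} (hβ : 0 < β) (U μ : ℝ) (K : TrigPolyC4v) {d k : ℕ} (jw : ℕ) (hd : 1 ≤ d) (hk : 1 ≤ k)
    (hZf : hubbardEffPartitionFnCT (b * L) M β U μ 0 K (klScale klE0 (d * k)) ≠ 0)
    (hZc : hubbardEffPartitionFnCT L M β U μ 0 K (klScale klE0 (d * k)) ≠ 0)
    {κ κb : ℝ} (hκ : 0 < κ) (hκb : 0 < κb) (hκκb : κ ^ 2 * (8 : ℝ) ^ (d * k) ≤ κb ^ 2)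
    (hGB : IsGramBoundedR ((sectorSubMatrix (b * L) M β (bgmFatMultiplier (b * L) M klE0 β (nambuXiCT (b * L) μ K) (d * k - 1))).transpose * hubbardCovSliceCT (b * L) M β μ 0 K (klScale klE0 (d * (k + 1))) (klScale klE0 (d * k)) * sectorSubMatrix (b * L) M β (bgmFatMultiplier (b * L) M klE0 β (nambuXiCT (b * L) μ K) (d * k - 1))) κ)
    {α αb : ℝ} (hαb : 0 < αb) (hααb : α ≤ αb * (4 : ℝ) ^ (d * k))
    (hrow : ∀ X, ∑ Y, ‖((sectorSubMatrix (b * L) M β (bgmFatMultiplier (b * L) M klE0 β (nambuXiCT (b * L) μ K) (d * k - 1))).transpose * hubbardCovSliceCT (b * L) M β μ 0 K (klScale klE0 (d * (k + 1))) (klScale klE0 (d * k)) * sectorSubMatrix (b * L) M β (bgmFatMultiplier (b * L) M klE0 β (nambuXiCT (b * L) μ K) (d * k - 1))) X Y‖ * klGluedWt L b M β jw (sectorCount (d * k - 1)) {X, Y} ≤ α)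
    (hcol : ∀ Y, ∑ X, ‖((sectorSubMatrix (b * L) M β (bgmFatMultiplier (b * L) M klE0 β (nambuXiCT (b * L) μ K) (d * k - 1))).transpose * hubbardCovSliceCT (b * L) M β μ 0 K (klScale klE0 (d * (k + 1))) (klScale klE0 (d * k)) * sectorSubMatrix (b * L) M β (bgmFatMultiplier (b * L) M klE0 β (nambuXiCT (b * L) μ K) (d * k - 1))) X Y‖ * klGluedWt L b M β jw (sectorCount (d * k - 1)) {X, Y} ≤ α)
    {D : ℕ} (hD : Fintype.card (SpaceTimeIdx (b * L) M × SectorLeg (sectorCount (d * k - 1))) / 2 ≤ D)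
    (Rin R' : ℕ) {Λ : ℝ} (hΛ1 : 1 ≤ Λ) (hΛle : Λ ≤ 1 + klScale klE0 jw * ((R' : ℝ) + 1))
    (jr : ℕ) {ΛT cW : ℝ} (hΛT : 0 ≤ ΛT) (hΛr : ΛT ≤ klScale klE0 jr) (hcW : 0 < cW)
    (hrowT : ∀ x, ∑ y', ‖klLipTransfer (b * L) M β μ K d k x y'‖ *
      klScaleWt (b * L) M β jr {latticeLegPos (2 * (2 * M)) x, latticeLegPos (2 * (2 * M)) y'} ≤ cW)
    (hcolT : ∀ y', ∑ x, ‖klLipTransfer (b * L) M β μ K d k x y'‖ *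
      klScaleWt (b * L) M β jr {latticeLegPos (2 * (2 * M)) x, latticeLegPos (2 * (2 * M)) y'} ≤ cW)
    (D₀ r : ℕ) (hD₀ : 2 * r ≤ D₀) (hRR' : Rin + R' ≤ D₀)
    {n p : ℕ} (hq : 2 * p = n + 1)
    {N Nfar Es NDs : ℝ} (hN0 : 0 ≤ N) (hNfar0 : 0 ≤ Nfar) (hEs0 : 0 ≤ Es) (hNDs0 : 0 ≤ NDs)
    (hN : ∀ (q : Fin (n + 1)) y, ∑ Y ∈ univ.filter (fun Y : Fin (n + 1) → SpaceTimeIdx L M × SectorLeg (sectorCount (d * k - 1)) => Y q = y),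
      ‖kernel ℂ (effAction ℂ (klLipCov L M β μ K d k) (klLipInput L M β U μ K d k) - klLipInput L M β U μ K d k) (n + 1) Y‖ ≤ N)
    (hNfar : ∀ (q : Fin (n + 1)) y (i : Fin (n + 1)),
      ∑ Y ∈ univ.filter (fun Y : Fin (n + 1) → SpaceTimeIdx L M × SectorLeg (sectorCount (d * k - 1)) => Y q = y ∧ r < Torus.tnorm ((Y q).1.2 - (Y i).1.2)),
        ‖kernel ℂ (effAction ℂ (klLipCov L M β μ K d k) (klLipInput L M β U μ K d k) - klLipInput L M β U μ K d k) (n + 1) Y‖ ≤ Nfar)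
    (hEs : ∀ (q : Fin (n + 1)) (y' : SpaceTimeIdx (b * L) M × SectorLeg (sectorCount (d * k - 1))), y' ∈ klDeepPins L D₀ →
      ∑ Y' ∈ univ.filter (fun Y' : Fin (n + 1) → SpaceTimeIdx (b * L) M × SectorLeg (sectorCount (d * k - 1)) => Y' q = y'),
        ‖kernel ℂ ((effAction ℂ (klLipCov (b * L) M β μ K d k) (klGlue L b M (sectorCount (d * k - 1)) (klLipInput L M β U μ K d k)) -
              klGlue L b M (sectorCount (d * k - 1)) (klLipInput L M β U μ K d k)) -
            klGlue L b M (sectorCount (d * k - 1))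
              (effAction ℂ (klLipCov L M β μ K d k) (klLipInput L M β U μ K d k) - klLipInput L M β U μ K d k)) (n + 1) Y'‖ ≤ Es)
    (hNDs : ∀ (q : Fin (n + 1)) (y' : SpaceTimeIdx (b * L) M × SectorLeg (sectorCount (d * k - 1))),
      ∑ Y' ∈ univ.filter (fun Y' : Fin (n + 1) → SpaceTimeIdx (b * L) M × SectorLeg (sectorCount (d * k - 1)) => Y' q = y'),
        ‖kernel ℂ ((effAction ℂ (klLipCov (b * L) M β μ K d k) (klGlue L b M (sectorCount (d * k - 1)) (klLipInput L M β U μ K d k)) -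
              klGlue L b M (sectorCount (d * k - 1)) (klLipInput L M β U μ K d k)) -
            klGlue L b M (sectorCount (d * k - 1))
              (effAction ℂ (klLipCov L M β μ K d k) (klLipInput L M β U μ K d k) - klLipInput L M β U μ K d k)) (n + 1) Y'‖ ≤ NDs)
    (hp3 : 3 ≤ p)
    -- the majorant's four-piece profile (one-volume, E1) and the budgeted profile of the difference array at this block
    {lam Q' A' ι₁ ι₂ ι₃ Aν κ₁ κ₂ κ₃ R : ℝ} (hlam : 0 < lam) (hQ' : 0 < Q') (hA' : 0 ≤ A') (hAν : 0 ≤ Aν) (hR : 0 ≤ R)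
    (hι₁ : (fun m => 32 * ((cW ^ 2 / 8) ^ m * (klTowerMeasWtAt L M β U μ K d k jw (2 * m) / klLevUnitF β M 0 m (d * k - 1) + (klTowerMeasWtAt (b * L) M β U μ K d k jw (2 * m) / klLevUnitF β M 0 m (d * k - 1) + klTowerMeasWtAt L M β U μ K d k jw (2 * m) / klLevUnitF β M 0 m (d * k - 1)) + klLipInputDiffSup L b M β U μ K d k (2 * m) Rin / (imagTimeWeight β M * klLevUnitF β M 0 m (d * k - 1))))) 1 ≤ ι₁ * lam) (hι₂ : (fun m => 32 * ((cW ^ 2 / 8) ^ m * (klTowerMeasWtAt L M β U μ K d k jw (2 * m) / klLevUnitF β M 0 m (d * k - 1) + (klTowerMeasWtAt (b * L) M β U μ K d k jw (2 * m) / klLevUnitF β M 0 m (d * k - 1) + klTowerMeasWtAt L M β U μ K d k jw (2 * m) / klLevUnitF β M 0 m (d * k - 1)) + klLipInputDiffSup L b M β U μ K d k (2 * m) Rin / (imagTimeWeight β M * klLevUnitF β M 0 m (d * k - 1))))) 2 ≤ ι₂ * lam) (hι₃ : (fun m => 32 * ((cW ^ 2 / 8) ^ m * (klTowerMeasWtAt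 L M β U μ K d k jw (2 * m) / klLevUnitF β M 0 m (d * k - 1) + (klTowerMeasWtAt (b * L) M β U μ K d k jw (2 * m) / klLevUnitF β M 0 m (d * k - 1) + klTowerMeasWtAt L M β U μ K d k jw (2 * m) / klLevUnitF β M 0 m (d * k - 1)) + klLipInputDiffSup L b M β U μ K d k (2 * m) Rin / (imagTimeWeight β M * klLevUnitF β M 0 m (d * k - 1))))) 3 ≤ ι₃ * lam ^ 2)
    (hprofb : ∀ m, 4 ≤ m → m ≤ D → (fun m => 32 * ((cW ^ 2 / 8) ^ m * (klTowerMeasWtAt L M β U μ K d k jw (2 * m) / klLevUnitF β M 0 m (d * k - 1) + (klTowerMeasWtAt (b * L) M β U μ K d k jw (2 * m) / klLevUnitF β M 0 m (d * k - 1) + klTowerMeasWtAt L M β U μ K d k jw (2 * m) / klLevUnitF β M 0 m (d * k - 1)) + klLipInputDiffSup L b M β U μ K d k (2 * m) Rin / (imagTimeWeight β M * klLevUnitF β M 0 m (d * k - 1))))) m ≤ A' * lam ^ (m - 1) * Q' ^ m)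
    (hν₁ : (fun m => 32 * ((cW ^ 2 / 8) ^ m * (klLipInputDiffSup L b M β U μ K d k (2 * m) Rin / (imagTimeWeight β M * klLevUnitF β M 0 m (d * k - 1)) + (Λ⁻¹ + 1 / (1 + ΛT * ((r : ℝ) + 1))) * (klTowerMeasWtAt (b * L) M β U μ K d k jw (2 * m) / klLevUnitF β M 0 m (d * k - 1) + klTowerMeasWtAt L M β U μ K d k jw (2 * m) / klLevUnitF β M 0 m (d * k - 1))))) 1 ≤ R * (κ₁ * lam)) (hν₂ : (fun m => 32 * ((cW ^ 2 / 8) ^ m * (klLipInputDiffSup L b M β U μ K d k (2 * m) Rin / (imagTimeWeight β M * klLevUnitF β M 0 m (d * k - 1)) + (Λ⁻¹ + 1 / (1 + ΛT * ((r : ℝ) + 1))) * (klTowerMeasWtAt (b * L) M β U μ K d k jw (2 * m) / klLevUnitF β M 0 m (d * k - 1) + klTowerMeasWtAt L M β U μ K d k jw (2 * m) / klLevUnitF β M 0 m (d * k - 1))))) 2 ≤ R * (κ₂ * lam)) (hν₃ : (fun m => 32 * ((cW ^ 2 / 8) ^ m * (klLipInputDiffSup L b M β U μ K d k (2 * m)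 Rin / (imagTimeWeight β M * klLevUnitF β M 0 m (d * k - 1)) + (Λ⁻¹ + 1 / (1 + ΛT * ((r : ℝ) + 1))) * (klTowerMeasWtAt (b * L) M β U μ K d k jw (2 * m) / klLevUnitF β M 0 m (d * k - 1) + klTowerMeasWtAt L M β U μ K d k jw (2 * m) / klLevUnitF β M 0 m (d * k - 1))))) 3 ≤ R * (κ₃ * lam ^ 2))
    (hνprof : ∀ m, 4 ≤ m → m ≤ D → (fun m => 32 * ((cW ^ 2 / 8) ^ m * (klLipInputDiffSup L b M β U μ K d k (2 * m) Rin / (imagTimeWeight β M * klLevUnitF β M 0 m (d * k - 1)) + (Λ⁻¹ + 1 / (1 + ΛT * ((r : ℝ) + 1))) * (klTowerMeasWtAt (b * L) M β U μ K d k jw (2 * m) / klLevUnitF β M 0 m (d * k - 1) + klTowerMeasWtAt L M β U μ K d k jw (2 * m) / klLevUnitF β M 0 m (d * k - 1))))) m ≤ R * (Aν * lam ^ (m - 1) * Q' ^ m))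
    -- the soft kit conditions at the LINK's constants
    (hx₁ : 4 * (κb ^ 2 * imagTimeWeight β M ^ 2 / cW ^ 2) * lam * Q' < 1) (hx₂ : 2 * lam * (4 * Real.exp 4 * κb ^ 2 * imagTimeWeight β M ^ 2 / cW ^ 2) * Q' ≤ 1) (hx₃ : Real.exp 1 * (4 * Real.exp 4 * κb ^ 2 * imagTimeWeight β M ^ 2 / cW ^ 2) * lam * Q' < 1)
    (hy : (Real.exp 1 * αb / κb ^ 2) * ((4 * Real.exp 4 * κb ^ 2 * imagTimeWeight β M ^ 2 / cW ^ 2) * (ι₁ * lam + ι₂ / (2 * Q') + ι₃ / (4 * Q' ^ 2) + A' * Q' / 4)) < 1)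
    (hθ : (Real.exp 1 * αb / κb ^ 2) * (Real.exp 1 * (4 * Real.exp 4 * κb ^ 2 * imagTimeWeight β M ^ 2 / cW ^ 2) * (ι₁ * lam) + (Real.exp 1 * (4 * Real.exp 4 * κb ^ 2 * imagTimeWeight β M ^ 2 / cW ^ 2)) ^ 2 * (ι₂ * lam) + (Real.exp 1 * (4 * Real.exp 4 * κb ^ 2 * imagTimeWeight β M ^ 2 / cW ^ 2)) ^ 3 * (ι₃ * lam ^ 2) + A' * (Real.exp 1 * (4 * Real.exp 4 * κb ^ 2 * imagTimeWeight β M ^ 2 / cW ^ 2) * Q') * ((Real.exp 1 * (4 * Real.exp 4 * κb ^ 2 * imagTimeWeight β M ^ 2 / cW ^ 2) * lam * Q') ^ 3 / (1 - Real.exp 1 * (4 * Real.exp 4 * κb ^ 2 * imagTimeWeight β M ^ 2 / cW ^ 2) * lam * Q'))) < 1) :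
    klLipBornDiffSup L b M β U μ K d k (n + 1) (D₀ + r) / (imagTimeWeight β M * klLevUnitF β M 0 p (d * k)) ≤
      R * (Aν * lam ^ (p - 1) * (4 * Q') ^ p * (4 * (κb ^ 2 * imagTimeWeight β M ^ 2 / cW ^ 2) * lam * Q' / (1 - 4 * (κb ^ 2 * imagTimeWeight β M ^ 2 / cW ^ 2) * lam * Q')) +
        Real.exp 1 * (cW ^ 2 / (κb ^ 2 * imagTimeWeight β M ^ 2)) ^ p * (2 * (4 * Real.exp 4 * κb ^ 2 * imagTimeWeight β M ^ 2 / cW ^ 2) * Q' * lam) ^ (p - 1) * ((4 * Real.exp 4 * κb ^ 2 * imagTimeWeight β M ^ 2 / cW ^ 2) * (κ₁ * lam + κ₂ / (2 * Q') + κ₃ / (4 * Q' ^ 2) + Aν * Q' / 4)) *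
          ((2 * ((Real.exp 1 * αb / κb ^ 2) * ((4 * Real.exp 4 * κb ^ 2 * imagTimeWeight β M ^ 2 / cW ^ 2) * (ι₁ * lam + ι₂ / (2 * Q') + ι₃ / (4 * Q' ^ 2) + A' * Q' / 4))) - ((Real.exp 1 * αb / κb ^ 2) * ((4 * Real.exp 4 * κb ^ 2 * imagTimeWeight β M ^ 2 / cW ^ 2) * (ι₁ * lam + ι₂ / (2 * Q') + ι₃ / (4 * Q' ^ 2) + A' * Q' / 4))) ^ 2) / (1 - (Real.exp 1 * αb / κb ^ 2) * ((4 * Real.exp 4 * κb ^ 2 * imagTimeWeight β M ^ 2 / cW ^ 2) * (ι₁ * lam + ι₂ / (2 * Q') + ι₃ / (4 * Q' ^ 2) + A' * Q' / 4))) ^ 2)) +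
      (cW ^ n * (cW * Es + cW / (1 + ΛT * ((r : ℝ) + 1)) * NDs) + (2 * cW ^ n * (cW / (1 + ΛT * ((r : ℝ) + 1))) * N + n * cW ^ n * (5 * (cW / (1 + ΛT * ((r : ℝ) + 1))) * N + 2 * cW * Nfar))) / (imagTimeWeight β M * klLevUnitF β M 0 p (d * k)) := by
  have hlink := fun (N' : ℕ) (hN' : 2 ≤ N') (hg : (Real.exp 1 * αb / κb ^ 2) * towerV D (4 * Real.exp 4 * κb ^ 2 * imagTimeWeight β M ^ 2 / cW ^ 2) (fun m => 32 * ((cW ^ 2 / 8) ^ m * (klTowerMeasWtAt L M β U μ K d k jw (2 * m) / klLevUnitF β M 0 m (d * k - 1) + (klTowerMeasWtAt (b * L) M β U μ K d k jw (2 * m) / klLevUnitF β M 0 m (d * k - 1) + klTowerMeasWtAt L M β U μ K d k jw (2 * m) / klLevUnitF β M 0 m (d * k - 1)) + klLipInputDiffSup L b M β U μ K d k (2 * m) Rin / (imagTimeWeight β M * klLevUnitF β M 0 m (d * k - 1))))) < 1) =>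
    klLipBornDiffSup_le_kitStep_of_bounds (L := L) (b := b) (M := M) hβ U μ K jw hd hk hZf hZc hκ hκb hκκb hGB hαb hααb hrow hcol hD Rin R' hΛ1 hΛle
      jr hΛT hΛr hcW hrowT hcolT D₀ r hD₀ hRR' hq hN0 hNfar0 hEs0 hNDs0 hN hNfar hEs hNDs (Nt := N') (by omega) hg
  have hx : 0 < imagTimeWeight β M := imagTimeWeight_pos_of_pos (M := M) hβ
  have hΛinv : 0 ≤ Λ⁻¹ := inv_nonneg.2 (zero_le_one.trans hΛ1)
  have hν0 : ∀ m, 0 ≤ (fun m => 32 * ((cW ^ 2 / 8) ^ m * (klLipInputDiffSup L b M β U μ K d k (2 * m) Rin / (imagTimeWeight β M * klLevUnitF β M 0 m (d * k - 1)) + (Λ⁻¹ + 1 / (1 + ΛT * ((r : ℝ) + 1))) * (klTowerMeasWtAt (b * L) M β U μ K d k jw (2 * m) / klLevUnitF β M 0 m (d * k - 1) + klTowerMeasWtAt L M β U μ K d k jw (2 * m) / klLevUnitF β M 0 m (d * k - 1))))) m := fun m => by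
    have h1 := klLipInputDiffSup_nonneg (L := L) (b := b) (M := M) β U μ K d k (2 * m) Rin
    have h2 := klTowerMeasWtAt_nonneg hβ.le U μ K d k jw (2 * m) (L := b * L) (M := M)
    have h3 := klTowerMeasWtAt_nonneg hβ.le U μ K d k jw (2 * m) (L := L) (M := M)
    have h4 := klLevUnitF_pos hβ (M := M) 0 m (d * k - 1)
    have h5 := hcW.le
    positivity
  have hμ0 : ∀ m, 0 ≤ (fun m => 32 * ((cW ^ 2 / 8) ^ m * (klTowerMeasWtAt L M β U μ K d k jw (2 * m) / klLevUnitF β M 0 m (d * k - 1) + (klTowerMeasWtAt (b * L) M β U μ K d k jw (2 * m) / klLevUnitF β M 0 m (d * k - 1) + klTowerMeasWtAt L M β U μ K d k jw (2 * m) / klLevUnitF β M 0 m (d * k - 1)) + klLipInputDiffSup L b M β U μ K d k (2 * m) Rin / (imagTimeWeight β M * klLevUnitF β M 0 m (d * k - 1))))) m := fun m => by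
    have h1 := klLipInputDiffSup_nonneg (L := L) (b := b) (M := M) β U μ K d k (2 * m) Rin
    have h2 := klTowerMeasWtAt_nonneg hβ.le U μ K d k jw (2 * m) (L := b * L) (M := M)
    have h3 := klTowerMeasWtAt_nonneg hβ.le U μ K d k jw (2 * m) (L := L) (M := M)
    have h4 := klLevUnitF_pos hβ (M := M) 0 m (d * k - 1)
    have h5 := hcW.le
    positivity
  exact lipStepImage_le_of_three_le' (D := D) hp3 (by positivity) (by positivity) (by positivity) (by positivity) (by norm_num) hlam hQ' hA' hAν hR hν0 hμ0
    hι₁ hι₂ hι₃ hprofb hν₁ hν₂ hν₃ hνprof hx₁ hx₂ hx₃ hy hθ hlink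

set_option maxHeartbeats 1600000 in -- large statement
/-- **The two-volume block step in BUDGET form, every degree `p ≥ 1`** (`lipStepImage_le_low'` ∘ the LINK; the graded part is `O(λ²)` — used in the degrees `p = 1, 2`). -/
theorem klLipBornDiffSup_le_budgetStep_low {β : ℝ} (hβ : 0 < β) (U μ : ℝ) (K : TrigPolyC4v) {d k : ℕ} (jw : ℕ) (hd : 1 ≤ d) (hk : 1 ≤ k)
    (hZf : hubbardEffPartitionFnCT (b * L) M β U μ 0 K (klScale klE0 (d * k)) ≠ 0)
    (hZc : hubbardEffPartitionFnCT L M β U μ 0 K (klScale klE0 (d * k)) ≠ 0)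
    {κ κb : ℝ} (hκ : 0 < κ) (hκb : 0 < κb) (hκκb : κ ^ 2 * (8 : ℝ) ^ (d * k) ≤ κb ^ 2)
    (hGB : IsGramBoundedR ((sectorSubMatrix (b * L) M β (bgmFatMultiplier (b * L) M klE0 β (nambuXiCT (b * L) μ K) (d * k - 1))).transpose * hubbardCovSliceCT (b * L) M β μ 0 K (klScale klE0 (d * (k + 1))) (klScale klE0 (d * k)) * sectorSubMatrix (b * L) M β (bgmFatMultiplier (b * L) M klE0 β (nambuXiCT (b * L) μ K) (d * k - 1))) κ)
    {α αb : ℝ} (hαb : 0 < αb) (hααb : α ≤ αb * (4 : ℝ) ^ (d * k))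
    (hrow : ∀ X, ∑ Y, ‖((sectorSubMatrix (b * L) M β (bgmFatMultiplier (b * L) M klE0 β (nambuXiCT (b * L) μ K) (d * k - 1))).transpose * hubbardCovSliceCT (b * L) M β μ 0 K (klScale klE0 (d * (k + 1))) (klScale klE0 (d * k)) * sectorSubMatrix (b * L) M β (bgmFatMultiplier (b * L) M klE0 β (nambuXiCT (b * L) μ K) (d * k - 1))) X Y‖ * klGluedWt L b M β jw (sectorCount (d * k - 1)) {X, Y} ≤ α)
    (hcol : ∀ Y, ∑ X, ‖((sectorSubMatrix (b * L) M β (bgmFatMultiplier (b * L) M klE0 β (nambuXiCT (b * L) μ K) (d * k - 1))).transpose * hubbardCovSliceCT (b * L) M β μ 0 K (klScale klE0 (d * (k + 1))) (klScale klE0 (d * k)) * sectorSubMatrix (b * L) M β (bgmFatMultiplier (b * L) M klE0 β (nambuXiCT (b * L) μ K) (d * k - 1))) X Y‖ * klGluedWt L b M β jw (sectorCount (d * k - 1)) {X, Y} ≤ α)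
    {D : ℕ} (hD : Fintype.card (SpaceTimeIdx (b * L) M × SectorLeg (sectorCount (d * k - 1))) / 2 ≤ D)
    (Rin R' : ℕ) {Λ : ℝ} (hΛ1 : 1 ≤ Λ) (hΛle : Λ ≤ 1 + klScale klE0 jw * ((R' : ℝ) + 1))
    (jr : ℕ) {ΛT cW : ℝ} (hΛT : 0 ≤ ΛT) (hΛr : ΛT ≤ klScale klE0 jr) (hcW : 0 < cW)
    (hrowT : ∀ x, ∑ y', ‖klLipTransfer (b * L) M β μ K d k x y'‖ *
      klScaleWt (b * L) M β jr {latticeLegPos (2 * (2 * M)) x, latticeLegPos (2 * (2 * M)) y'} ≤ cW)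
    (hcolT : ∀ y', ∑ x, ‖klLipTransfer (b * L) M β μ K d k x y'‖ *
      klScaleWt (b * L) M β jr {latticeLegPos (2 * (2 * M)) x, latticeLegPos (2 * (2 * M)) y'} ≤ cW)
    (D₀ r : ℕ) (hD₀ : 2 * r ≤ D₀) (hRR' : Rin + R' ≤ D₀)
    {n p : ℕ} (hq : 2 * p = n + 1)
    {N Nfar Es NDs : ℝ} (hN0 : 0 ≤ N) (hNfar0 : 0 ≤ Nfar) (hEs0 : 0 ≤ Es) (hNDs0 : 0 ≤ NDs)
    (hN : ∀ (q : Fin (n + 1)) y, ∑ Y ∈ univ.filter (fun Y : Fin (n + 1) → SpaceTimeIdx L M × SectorLeg (sectorCount (d * k - 1)) => Y q = y),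
      ‖kernel ℂ (effAction ℂ (klLipCov L M β μ K d k) (klLipInput L M β U μ K d k) - klLipInput L M β U μ K d k) (n + 1) Y‖ ≤ N)
    (hNfar : ∀ (q : Fin (n + 1)) y (i : Fin (n + 1)),
      ∑ Y ∈ univ.filter (fun Y : Fin (n + 1) → SpaceTimeIdx L M × SectorLeg (sectorCount (d * k - 1)) => Y q = y ∧ r < Torus.tnorm ((Y q).1.2 - (Y i).1.2)),
        ‖kernel ℂ (effAction ℂ (klLipCov L M β μ K d k) (klLipInput L M β U μ K d k) - klLipInput L M β U μ K d k) (n + 1) Y‖ ≤ Nfar)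
    (hEs : ∀ (q : Fin (n + 1)) (y' : SpaceTimeIdx (b * L) M × SectorLeg (sectorCount (d * k - 1))), y' ∈ klDeepPins L D₀ →
      ∑ Y' ∈ univ.filter (fun Y' : Fin (n + 1) → SpaceTimeIdx (b * L) M × SectorLeg (sectorCount (d * k - 1)) => Y' q = y'),
        ‖kernel ℂ ((effAction ℂ (klLipCov (b * L) M β μ K d k) (klGlue L b M (sectorCount (d * k - 1)) (klLipInput L M β U μ K d k)) -
              klGlue L b M (sectorCount (d * k - 1)) (klLipInput L M β U μ K d k)) -
            klGlue L b M (sectorCount (d * k - 1))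
              (effAction ℂ (klLipCov L M β μ K d k) (klLipInput L M β U μ K d k) - klLipInput L M β U μ K d k)) (n + 1) Y'‖ ≤ Es)
    (hNDs : ∀ (q : Fin (n + 1)) (y' : SpaceTimeIdx (b * L) M × SectorLeg (sectorCount (d * k - 1))),
      ∑ Y' ∈ univ.filter (fun Y' : Fin (n + 1) → SpaceTimeIdx (b * L) M × SectorLeg (sectorCount (d * k - 1)) => Y' q = y'),
        ‖kernel ℂ ((effAction ℂ (klLipCov (b * L) M β μ K d k) (klGlue L b M (sectorCount (d * k - 1)) (klLipInput L M β U μ K d k)) -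
              klGlue L b M (sectorCount (d * k - 1)) (klLipInput L M β U μ K d k)) -
            klGlue L b M (sectorCount (d * k - 1))
              (effAction ℂ (klLipCov L M β μ K d k) (klLipInput L M β U μ K d k) - klLipInput L M β U μ K d k)) (n + 1) Y'‖ ≤ NDs)
    -- the majorant's four-piece profile (one-volume, E1) and the budgeted profile of the difference array at this block
    {lam Q' A' ι₁ ι₂ ι₃ Aν κ₁ κ₂ κ₃ R : ℝ} (hlam : 0 < lam) (hQ' : 0 < Q') (hA' : 0 ≤ A') (hAν : 0 ≤ Aν) (hR : 0 ≤ R)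
    (hκ₁0 : 0 ≤ κ₁) (hκ₂0 : 0 ≤ κ₂) (hκ₃0 : 0 ≤ κ₃)
    (hι₁ : (fun m => 32 * ((cW ^ 2 / 8) ^ m * (klTowerMeasWtAt L M β U μ K d k jw (2 * m) / klLevUnitF β M 0 m (d * k - 1) + (klTowerMeasWtAt (b * L) M β U μ K d k jw (2 * m) / klLevUnitF β M 0 m (d * k - 1) + klTowerMeasWtAt L M β U μ K d k jw (2 * m) / klLevUnitF β M 0 m (d * k - 1)) + klLipInputDiffSup L b M β U μ K d k (2 * m) Rin / (imagTimeWeight β M * klLevUnitF β M 0 m (d * k - 1))))) 1 ≤ ι₁ * lam) (hι₂ : (fun m => 32 * ((cW ^ 2 / 8) ^ m * (klTowerMeasWtAt L M β U μ K d k jw (2 * m) / klLevUnitF β M 0 m (d * k - 1) + (klTowerMeasWtAt (b * L) M β U μ K d k jw (2 * m) / klLevUnitF β M 0 m (d * k - 1) + klTowerMeasWtAt L M β U μ K d k jw (2 * m) / klLevUnitF β M 0 m (d * k - 1)) + klLipInputDiffSup L b M β U μ K d k (2 * m) Rin / (imagTimeWeight β M * klLevUnitF β M 0 m (d * k - 1)))))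 2 ≤ ι₂ * lam) (hι₃ : (fun m => 32 * ((cW ^ 2 / 8) ^ m * (klTowerMeasWtAt L M β U μ K d k jw (2 * m) / klLevUnitF β M 0 m (d * k - 1) + (klTowerMeasWtAt (b * L) M β U μ K d k jw (2 * m) / klLevUnitF β M 0 m (d * k - 1) + klTowerMeasWtAt L M β U μ K d k jw (2 * m) / klLevUnitF β M 0 m (d * k - 1)) + klLipInputDiffSup L b M β U μ K d k (2 * m) Rin / (imagTimeWeight β M * klLevUnitF β M 0 m (d * k - 1))))) 3 ≤ ι₃ * lam ^ 2)
    (hprofb : ∀ m, 4 ≤ m → m ≤ D → (fun m => 32 * ((cW ^ 2 / 8) ^ m * (klTowerMeasWtAt L M β U μ K d k jw (2 * m) / klLevUnitF β M 0 m (d * k - 1) + (klTowerMeasWtAt (b * L) M β U μ K d k jw (2 * m) / klLevUnitF β M 0 m (d * k - 1) + klTowerMeasWtAt L M β U μ K d k jw (2 * m) / klLevUnitF β M 0 m (d * k - 1)) + klLipInputDiffSup L b M β U μ K d k (2 * m) Rin / (imagTimeWeight β M * klLevUnitF β M 0 m (d * k - 1))))) m ≤ A' * lam ^ (m - 1) *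 Q' ^ m)
    (hν₁ : (fun m => 32 * ((cW ^ 2 / 8) ^ m * (klLipInputDiffSup L b M β U μ K d k (2 * m) Rin / (imagTimeWeight β M * klLevUnitF β M 0 m (d * k - 1)) + (Λ⁻¹ + 1 / (1 + ΛT * ((r : ℝ) + 1))) * (klTowerMeasWtAt (b * L) M β U μ K d k jw (2 * m) / klLevUnitF β M 0 m (d * k - 1) + klTowerMeasWtAt L M β U μ K d k jw (2 * m) / klLevUnitF β M 0 m (d * k - 1))))) 1 ≤ R * (κ₁ * lam)) (hν₂ : (fun m => 32 * ((cW ^ 2 / 8) ^ m * (klLipInputDiffSup L b M β U μ K d k (2 * m) Rin / (imagTimeWeight β M * klLevUnitF β M 0 m (d * k - 1)) + (Λ⁻¹ + 1 / (1 + ΛT * ((r : ℝ) + 1))) * (klTowerMeasWtAt (b * L) M β U μ K d k jw (2 * m) / klLevUnitF β M 0 m (d * k - 1) + klTowerMeasWtAt L M β U μ K d k jw (2 * m) / klLevUnitF β M 0 m (d * k - 1))))) 2 ≤ R * (κ₂ * lam)) (hν₃ : (fun m => 32 * ((cW ^ 2 / 8) ^ m * (klLipInputDiffSup L b M β U μ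 K d k (2 * m) Rin / (imagTimeWeight β M * klLevUnitF β M 0 m (d * k - 1)) + (Λ⁻¹ + 1 / (1 + ΛT * ((r : ℝ) + 1))) * (klTowerMeasWtAt (b * L) M β U μ K d k jw (2 * m) / klLevUnitF β M 0 m (d * k - 1) + klTowerMeasWtAt L M β U μ K d k jw (2 * m) / klLevUnitF β M 0 m (d * k - 1))))) 3 ≤ R * (κ₃ * lam ^ 2))
    (hνprof : ∀ m, 4 ≤ m → m ≤ D → (fun m => 32 * ((cW ^ 2 / 8) ^ m * (klLipInputDiffSup L b M β U μ K d k (2 * m) Rin / (imagTimeWeight β M * klLevUnitF β M 0 m (d * k - 1)) + (Λ⁻¹ + 1 / (1 + ΛT * ((r : ℝ) + 1))) * (klTowerMeasWtAt (b * L) M β U μ K d k jw (2 * m) / klLevUnitF β M 0 m (d * k - 1) + klTowerMeasWtAt L M β U μ K d k jw (2 * m) / klLevUnitF β M 0 m (d * k - 1))))) m ≤ R * (Aν * lam ^ (m - 1) * Q' ^ m))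
    -- the soft kit conditions at the LINK's constants
    (hx₁ : 4 * (κb ^ 2 * imagTimeWeight β M ^ 2 / cW ^ 2) * lam * Q' < 1) (hx₃ : Real.exp 1 * (4 * Real.exp 4 * κb ^ 2 * imagTimeWeight β M ^ 2 / cW ^ 2) * lam * Q' < 1)
    (hy₁ : (Real.exp 1 * αb / κb ^ 2) * ((4 * Real.exp 4 * κb ^ 2 * imagTimeWeight β M ^ 2 / cW ^ 2) * (ι₁ * lam) + (4 * Real.exp 4 * κb ^ 2 * imagTimeWeight β M ^ 2 / cW ^ 2) ^ 2 * (ι₂ * lam) + (4 * Real.exp 4 * κb ^ 2 * imagTimeWeight β M ^ 2 / cW ^ 2) ^ 3 * (ι₃ * lam ^ 2) + A' * ((4 * Real.exp 4 * κb ^ 2 * imagTimeWeight β M ^ 2 / cW ^ 2) * Q') * (((4 * Real.exp 4 * κb ^ 2 * imagTimeWeight β M ^ 2 / cW ^ 2) * lam * Q') ^ 3 / (1 - (4 * Real.exp 4 * κb ^ 2 * imagTimeWeight β M ^ 2 / cW ^ 2) * lam * Q'))) < 1)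
    (hθ : (Real.exp 1 * αb / κb ^ 2) * (Real.exp 1 * (4 * Real.exp 4 * κb ^ 2 * imagTimeWeight β M ^ 2 / cW ^ 2) * (ι₁ * lam) + (Real.exp 1 * (4 * Real.exp 4 * κb ^ 2 * imagTimeWeight β M ^ 2 / cW ^ 2)) ^ 2 * (ι₂ * lam) + (Real.exp 1 * (4 * Real.exp 4 * κb ^ 2 * imagTimeWeight β M ^ 2 / cW ^ 2)) ^ 3 * (ι₃ * lam ^ 2) + A' * (Real.exp 1 * (4 * Real.exp 4 * κb ^ 2 * imagTimeWeight β M ^ 2 / cW ^ 2) * Q') * ((Real.exp 1 * (4 * Real.exp 4 * κb ^ 2 * imagTimeWeight β M ^ 2 / cW ^ 2) * lam * Q') ^ 3 / (1 - Real.exp 1 * (4 * Real.exp 4 * κb ^ 2 * imagTimeWeight β M ^ 2 / cW ^ 2) * lam * Q'))) < 1)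
    (hxτ : (4 * Real.exp 4 * κb ^ 2 * imagTimeWeight β M ^ 2 / cW ^ 2) * lam * Q' < 1) :
    klLipBornDiffSup L b M β U μ K d k (n + 1) (D₀ + r) / (imagTimeWeight β M * klLevUnitF β M 0 p (d * k)) ≤
      R * ((Aν + κ₁ * lam / Q' + κ₂ / Q' ^ 2 + κ₃ / Q' ^ 3) * lam ^ (p - 1) * (4 * Q') ^ p * (4 * (κb ^ 2 * imagTimeWeight β M ^ 2 / cW ^ 2) * lam * Q' / (1 - 4 * (κb ^ 2 * imagTimeWeight β M ^ 2 / cW ^ 2) * lam * Q')) +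
        Real.exp 1 * (cW ^ 2 / (κb ^ 2 * imagTimeWeight β M ^ 2)) ^ p * ((4 * Real.exp 4 * κb ^ 2 * imagTimeWeight β M ^ 2 / cW ^ 2) * (κ₁ * lam) + (4 * Real.exp 4 * κb ^ 2 * imagTimeWeight β M ^ 2 / cW ^ 2) ^ 2 * (κ₂ * lam) + (4 * Real.exp 4 * κb ^ 2 * imagTimeWeight β M ^ 2 / cW ^ 2) ^ 3 * (κ₃ * lam ^ 2) + Aν * ((4 * Real.exp 4 * κb ^ 2 * imagTimeWeight β M ^ 2 / cW ^ 2) * Q') * (((4 * Real.exp 4 * κb ^ 2 * imagTimeWeight β M ^ 2 / cW ^ 2) * lam * Q') ^ 3 / (1 - (4 * Real.exp 4 * κb ^ 2 * imagTimeWeight β M ^ 2 / cW ^ 2) * lam * Q'))) * ((2 * ((Real.exp 1 * αb / κb ^ 2) * ((4 * Real.exp 4 * κb ^ 2 * imagTimeWeight β M ^ 2 / cW ^ 2) * (ι₁ * lam) + (4 * Real.exp 4 * κb ^ 2 * imagTimeWeight β M ^ 2 / cW ^ 2) ^ 2 * (ι₂ * lam) + (4 * Real.exp 4 * κb ^ 2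 * imagTimeWeight β M ^ 2 / cW ^ 2) ^ 3 * (ι₃ * lam ^ 2) + A' * ((4 * Real.exp 4 * κb ^ 2 * imagTimeWeight β M ^ 2 / cW ^ 2) * Q') * (((4 * Real.exp 4 * κb ^ 2 * imagTimeWeight β M ^ 2 / cW ^ 2) * lam * Q') ^ 3 / (1 - (4 * Real.exp 4 * κb ^ 2 * imagTimeWeight β M ^ 2 / cW ^ 2) * lam * Q')))) - ((Real.exp 1 * αb / κb ^ 2) * ((4 * Real.exp 4 * κb ^ 2 * imagTimeWeight β M ^ 2 / cW ^ 2) * (ι₁ * lam) + (4 * Real.exp 4 * κb ^ 2 * imagTimeWeight β M ^ 2 / cW ^ 2) ^ 2 * (ι₂ * lam) + (4 * Real.exp 4 * κb ^ 2 * imagTimeWeight β M ^ 2 / cW ^ 2) ^ 3 * (ι₃ * lam ^ 2) + A' * ((4 * Real.exp 4 * κb ^ 2 * imagTimeWeight β M ^ 2 / cW ^ 2) * Q') * (((4 * Real.exp 4 * κb ^ 2 * imagTimeWeight β M ^ 2 / cW ^ 2) * lam * Q') ^ 3 / (1 - (4 * Real.exp 4 * κb ^ 2 * imagTimeWeight β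 M ^ 2 / cW ^ 2) * lam * Q')))) ^ 2) / (1 - (Real.exp 1 * αb / κb ^ 2) * ((4 * Real.exp 4 * κb ^ 2 * imagTimeWeight β M ^ 2 / cW ^ 2) * (ι₁ * lam) + (4 * Real.exp 4 * κb ^ 2 * imagTimeWeight β M ^ 2 / cW ^ 2) ^ 2 * (ι₂ * lam) + (4 * Real.exp 4 * κb ^ 2 * imagTimeWeight β M ^ 2 / cW ^ 2) ^ 3 * (ι₃ * lam ^ 2) + A' * ((4 * Real.exp 4 * κb ^ 2 * imagTimeWeight β M ^ 2 / cW ^ 2) * Q') * (((4 * Real.exp 4 * κb ^ 2 * imagTimeWeight β M ^ 2 / cW ^ 2) * lam * Q') ^ 3 / (1 - (4 * Real.exp 4 * κb ^ 2 * imagTimeWeight β M ^ 2 / cW ^ 2) * lam * Q')))) ^ 2)) +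
      (cW ^ n * (cW * Es + cW / (1 + ΛT * ((r : ℝ) + 1)) * NDs) + (2 * cW ^ n * (cW / (1 + ΛT * ((r : ℝ) + 1))) * N + n * cW ^ n * (5 * (cW / (1 + ΛT * ((r : ℝ) + 1))) * N + 2 * cW * Nfar))) / (imagTimeWeight β M * klLevUnitF β M 0 p (d * k)) := by
  have hlink := fun (N' : ℕ) (hN' : 2 ≤ N') (hg : (Real.exp 1 * αb / κb ^ 2) * towerV D (4 * Real.exp 4 * κb ^ 2 * imagTimeWeight β M ^ 2 / cW ^ 2) (fun m => 32 * ((cW ^ 2 / 8) ^ m * (klTowerMeasWtAt L M β U μ K d k jw (2 * m) / klLevUnitF β M 0 m (d * k - 1) + (klTowerMeasWtAt (b * L) M β U μ K d k jw (2 * m) / klLevUnitF β M 0 m (d * k - 1) + klTowerMeasWtAt L M β U μ K d k jw (2 * m) / klLevUnitF β M 0 m (d * k - 1)) + klLipInputDiffSup L b M β U μ K d k (2 * m) Rin / (imagTimeWeight β M * klLevUnitF β M 0 m (d * k - 1))))) < 1) =>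
    klLipBornDiffSup_le_kitStep_of_bounds (L := L) (b := b) (M := M) hβ U μ K jw hd hk hZf hZc hκ hκb hκκb hGB hαb hααb hrow hcol hD Rin R' hΛ1 hΛle
      jr hΛT hΛr hcW hrowT hcolT D₀ r hD₀ hRR' hq hN0 hNfar0 hEs0 hNDs0 hN hNfar hEs hNDs (Nt := N') (by omega) hg
  have hx : 0 < imagTimeWeight β M := imagTimeWeight_pos_of_pos (M := M) hβ
  have hΛinv : 0 ≤ Λ⁻¹ := inv_nonneg.2 (zero_le_one.trans hΛ1)
  have hν0 : ∀ m, 0 ≤ (fun m => 32 * ((cW ^ 2 / 8) ^ m * (klLipInputDiffSup L b M β U μ K d k (2 * m) Rin / (imagTimeWeight β M * klLevUnitF β M 0 m (d * k - 1)) + (Λ⁻¹ + 1 / (1 + ΛT * ((r : ℝ) + 1))) * (klTowerMeasWtAt (b * L) M β U μ K d k jw (2 * m) / klLevUnitF β M 0 m (d * k - 1) + klTowerMeasWtAt L M β U μ K d k jw (2 * m) / klLevUnitF β M 0 m (d * k - 1))))) m := fun m => by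
    have h1 := klLipInputDiffSup_nonneg (L := L) (b := b) (M := M) β U μ K d k (2 * m) Rin
    have h2 := klTowerMeasWtAt_nonneg hβ.le U μ K d k jw (2 * m) (L := b * L) (M := M)
    have h3 := klTowerMeasWtAt_nonneg hβ.le U μ K d k jw (2 * m) (L := L) (M := M)
    have h4 := klLevUnitF_pos hβ (M := M) 0 m (d * k - 1)
    have h5 := hcW.le
    positivity
  have hμ0 : ∀ m, 0 ≤ (fun m => 32 * ((cW ^ 2 / 8) ^ m * (klTowerMeasWtAt L M β U μ K d k jw (2 * m) / klLevUnitF β M 0 m (d * k - 1) + (klTowerMeasWtAt (b * L) M β U μ K d k jw (2 * m) / klLevUnitF β M 0 m (d * k - 1) + klTowerMeasWtAt L M β U μ K d k jw (2 * m) / klLevUnitF β M 0 m (d * k - 1)) + klLipInputDiffSup L b M β U μ K d k (2 * m) Rin / (imagTimeWeight β M * klLevUnitF β M 0 m (d * k - 1))))) m := fun m => by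
    have h1 := klLipInputDiffSup_nonneg (L := L) (b := b) (M := M) β U μ K d k (2 * m) Rin
    have h2 := klTowerMeasWtAt_nonneg hβ.le U μ K d k jw (2 * m) (L := b * L) (M := M)
    have h3 := klTowerMeasWtAt_nonneg hβ.le U μ K d k jw (2 * m) (L := L) (M := M)
    have h4 := klLevUnitF_pos hβ (M := M) 0 m (d * k - 1)
    have h5 := hcW.le
    positivity
  exact lipStepImage_le_low' (D := D) (by omega : 1 ≤ p) (by positivity) (by positivity) (by positivity) (by positivity) (by norm_num) hlam hQ' hA' hAν hR hκ₁0 hκ₂0 hκ₃0 hν0 hμ0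
    hι₁ hι₂ hι₃ hprofb hν₁ hν₂ hν₃ hνprof hx₁ hxτ hx₃ hy₁ hθ hlink

end Summit.HubbardSuperconductivity.HubbardSuperconductivity.Theorems.TwoVolumeLip

end
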